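import Summits.Ventures.YMGap.Thresholds.LatticeBakryEmeryLipschitz
import Literature.MathematicalPhysics.QuantumFieldTheory.LatticeGaugeDobrushin
import Literature.MathematicalPhysics.QuantumFieldTheory.TorusPlaquetteNeighbours
import Mathlib.Probability.Moments.Covariance
import HarnessLib

/-!
# Venture YMGap — track (a), R119 brick L, part 2a: preparation for the tight-limit transfer —
# covariance perturbation under uniform approximation, and smooth cylinder functions read on a torus

HONEST FRAMING: venture file (cell `pub-ymgap`, track (a), seat ds-2, brick L for lit-1's R119 line).
Elementary probability (covariances of bounded functions move by `O(η)` under uniform `η`-perturbation)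
and lattice bookkeeping (a smooth `K`-Lipschitz function of the matrix entries on a finite edge set
`Λ ⊂ E(ℤ^d)`, read through the periodic projection `π_L`, is a smooth ambient function on
`(E⁺(Λ_L) → M_N(ℂ))` that is `LinkLipschitz` with per-link data `K · #{e ∈ Λ : π_L e = e'}` of total
mass `K·|Λ|`). No measure on configurations beyond an abstract probability space; no physics.
Consumed by `SharpClusteringLimit.lean`.

References: H. Shen, R. Zhu, X. Zhu, CMP 400 (2023) 805–851, Cor. 4.11 (cylinder functions,
Lipschitz seminorms); cell file `ds/ds2-g5/LIMIT-BRICK-OFFER.md`.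
-/

noncomputable section

open MeasureTheory ProbabilityTheory Filter Topology Finset
open scoped NNReal ContDiff Matrix.Norms.Frobenius
open Literature.MathematicalPhysics.QuantumLattice (LGConfig ZdEdge torusEdge)
open Literature.MathematicalPhysics.QuantumFieldTheory hiding ZdEdge
open Summit.Ventures.YMGap.LatticeBakryEmery (Cfg PSU emb emb_apply LinkLipschitz)

namespace Summit.Ventures.YMGap

namespace SharpClustering

/-! ### Covariances of bounded functions move little under uniform perturbation -/

section Cov

variable {Ω : Type*} [MeasurableSpace Ω] {μ : Measure Ω} [IsProbabilityMeasure μ]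

/-- `|∫ f| ≤ C` if `|f| ≤ C` pointwise (probability measure). -/
theorem abs_integral_le_of_abs_le {f : Ω → ℝ} {C : ℝ} (hf : ∀ z, |f z| ≤ C) : |∫ z, f z ∂μ| ≤ C := by
  obtain ⟨z₀⟩ := μ.nonempty_of_neZero
  have hC : 0 ≤ C := (abs_nonneg _).trans (hf z₀)
  refine (abs_integral_le_integral_abs).trans ?_
  by_cases hi : Integrable (fun z => |f z|) μ
  · calc ∫ z, |f z| ∂μ ≤ ∫ _, C ∂μ := integral_mono hi (integrable_const C) hf
      _ = C := by simp
  · rw [integral_undef hi]; exact hC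

/-- Bounded measurable functions are in `L²` of a probability measure. -/
theorem memLp_two_of_abs_le {f : Ω → ℝ} (hm : AEStronglyMeasurable f μ) {C : ℝ} (hf : ∀ z, |f z| ≤ C) :
    MemLp f 2 μ :=
  MemLp.of_bound hm C (ae_of_all _ fun z => by rw [Real.norm_eq_abs]; exact hf z)

/-- **Covariance perturbation**: if `|X - X'| ≤ ε₁`, `|Y - Y'| ≤ ε₂`, `|X'| ≤ a`, `|Y| ≤ b` pointwise
(all measurable), then `|cov(X,Y) - cov(X',Y')| ≤ 2(ε₁ b + a ε₂)`. -/
theorem abs_cov_sub_cov_le {X X' Y Y' : Ω → ℝ} (hXm : AEStronglyMeasurable X μ)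
    (hX'm : AEStronglyMeasurable X' μ) (hYm : AEStronglyMeasurable Y μ) (hY'm : AEStronglyMeasurable Y' μ)
    {a b ε₁ ε₂ : ℝ} (hX' : ∀ z, |X' z| ≤ a) (hY : ∀ z, |Y z| ≤ b) (hXX' : ∀ z, |X z - X' z| ≤ ε₁)
    (hYY' : ∀ z, |Y z - Y' z| ≤ ε₂) :
    |cov[X, Y; μ] - cov[X', Y'; μ]| ≤ 2 * (ε₁ * b + a * ε₂) := by
  classical
  obtain ⟨z₀⟩ := μ.nonempty_of_neZero
  have ha : 0 ≤ a := (abs_nonneg _).trans (hX' z₀)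
  have hb : 0 ≤ b := (abs_nonneg _).trans (hY z₀)
  have he₁ : 0 ≤ ε₁ := (abs_nonneg _).trans (hXX' z₀)
  have he₂ : 0 ≤ ε₂ := (abs_nonneg _).trans (hYY' z₀)
  have hX : ∀ z, |X z| ≤ a + ε₁ := fun z => by
    calc |X z| = |X' z + (X z - X' z)| := by ring_nf
      _ ≤ |X' z| + |X z - X' z| := abs_add_le _ _
      _ ≤ a + ε₁ := add_le_add (hX' z) (hXX' z)
  have hY' : ∀ z, |Y' z| ≤ b + ε₂ := fun z => by
    calc |Y' z| = |Y z - (Y z - Y' z)| := by ring_nf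
      _ ≤ |Y z| + |Y z - Y' z| := abs_sub _ _
      _ ≤ b + ε₂ := add_le_add (hY z) (hYY' z)
  have mX := memLp_two_of_abs_le hXm hX
  have mX' := memLp_two_of_abs_le hX'm hX'
  have mY := memLp_two_of_abs_le hYm hY
  have mY' := memLp_two_of_abs_le hY'm hY'
  rw [covariance_eq_sub mX mY, covariance_eq_sub mX' mY']
  -- the four elementary estimates
  have i1 : |∫ z, (X * Y) z ∂μ - ∫ z, (X' * Y') z ∂μ| ≤ ε₁ * b + a * ε₂ := by
    rw [← integral_sub (mX.integrable_mul mY) (mX'.integrable_mul mY')]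
    refine abs_integral_le_of_abs_le fun z => ?_
    simp only [Pi.mul_apply]
    have e : X z * Y z - X' z * Y' z = (X z - X' z) * Y z + X' z * (Y z - Y' z) := by ring
    rw [e]
    refine (abs_add_le _ _).trans (add_le_add ?_ ?_)
    · rw [abs_mul]; exact mul_le_mul (hXX' z) (hY z) (abs_nonneg _) he₁
    · rw [abs_mul]; exact mul_le_mul (hX' z) (hYY' z) (abs_nonneg _) ha
  have i2 : |∫ z, X z ∂μ - ∫ z, X' z ∂μ| ≤ ε₁ := by
    rw [← integral_sub (mX.integrable one_le_two) (mX'.integrable one_le_two)]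
    exact abs_integral_le_of_abs_le hXX'
  have i3 : |∫ z, Y z ∂μ - ∫ z, Y' z ∂μ| ≤ ε₂ := by
    rw [← integral_sub (mY.integrable one_le_two) (mY'.integrable one_le_two)]
    exact abs_integral_le_of_abs_le hYY'
  have i4 : |∫ z, Y z ∂μ| ≤ b := abs_integral_le_of_abs_le hY
  have i5 : |∫ z, X' z ∂μ| ≤ a := abs_integral_le_of_abs_le hX'
  -- combine
  have e : ((∫ z, (X * Y) z ∂μ) - (∫ z, X z ∂μ) * ∫ z, Y z ∂μ) -
      ((∫ z, (X' * Y') z ∂μ) - (∫ z, X' z ∂μ) * ∫ z, Y' z ∂μ) =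
      ((∫ z, (X * Y) z ∂μ) - ∫ z, (X' * Y') z ∂μ) -
        (((∫ z, X z ∂μ) - ∫ z, X' z ∂μ) * (∫ z, Y z ∂μ) +
          (∫ z, X' z ∂μ) * ((∫ z, Y z ∂μ) - ∫ z, Y' z ∂μ)) := by ring
  rw [e]
  refine (abs_sub _ _).trans ?_
  have j : |((∫ z, X z ∂μ) - ∫ z, X' z ∂μ) * (∫ z, Y z ∂μ) +
      (∫ z, X' z ∂μ) * ((∫ z, Y z ∂μ) - ∫ z, Y' z ∂μ)| ≤ ε₁ * b + a * ε₂ := by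
    refine (abs_add_le _ _).trans (add_le_add ?_ ?_)
    · rw [abs_mul]; exact mul_le_mul i2 i4 (abs_nonneg _) he₁
    · rw [abs_mul]; exact mul_le_mul i5 i3 (abs_nonneg _) ha
  linarith

end Cov

/-! ### Smooth cylinder functions read on a torus -/

section Torus

variable {d N : ℕ}


/-- `setDistEdges` is at most the sup-distance of the base points of any pair of edges (any `d`; the
tree's `StarLimit.setDistEdges_le_supNorm` is the case `d = 4`). -/
theorem setDistEdges_le_supNorm_of_mem
    {Λ₁ Λ₂ : Finset (ZdEdge d)}
    {a b : ZdEdge d} (ha : a ∈ Λ₁) (hb : b ∈ Λ₂) :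
    setDistEdges Λ₁ Λ₂ ≤ (Literature.Probability.LatticeModels.Site.supNorm (a.1 - b.1) : ℝ) := by
  have hne : (Λ₁ ×ˢ Λ₂).Nonempty := ⟨(a, b), Finset.mk_mem_product ha hb⟩
  unfold setDistEdges
  rw [dif_pos hne, ← Literature.Probability.LatticeModels.Site.norm_eq_supNorm]
  exact Finset.inf'_le (fun p : ZdEdge d ×
      ZdEdge d => ‖p.1.1 - p.2.1‖)
    (Finset.mk_mem_product ha hb)

/-- **The smooth cylinder function read on the torus**: for `g : (Λ → Fin N → Fin N → ℂ) → ℝ` smooth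
and `K`-Lipschitz (sup metric), the ambient function `u(Q) = g((Q_{π_L e})_{e ∈ Λ})` on
`(E⁺(Λ_L) → M_N(ℂ))` is smooth and `LinkLipschitz` with data `δ_{e'} = K · #{e ∈ Λ : π_L e = e'}`. -/
theorem torusPullback_smooth_linkLipschitz {L : ℕ} [NeZero L]
    (Λ : Finset (ZdEdge d))
    {g : (↥Λ → Fin N → Fin N → ℂ) → ℝ} (hg : ContDiff ℝ ∞ g) {K : ℝ≥0} (hgK : LipschitzWith K g) :
    ContDiff ℝ ∞ (fun Q : Cfg (Edge d L) N => g fun (e : ↥Λ) (i j : Fin N) =>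
        Q (torusEdge L (e : ZdEdge d)) i j) ∧
      LinkLipschitz (fun Q : Cfg (Edge d L) N => g fun (e : ↥Λ) (i j : Fin N) =>
        Q (torusEdge L (e : ZdEdge d)) i j)
        (fun e' => (K : ℝ) * ∑ e : ↥Λ,
          if torusEdge L (e : ZdEdge d) = e' then (1 : ℝ) else 0) := by
  classical
  -- the entry-tuple map is real-linear, hence smooth (finite dimension)
  let Tl : Cfg (Edge d L) N →ₗ[ℝ] (↥Λ → Fin N → Fin N → ℂ) :=
    { toFun := fun Q e i j => Q (torusEdge L (e : ZdEdge d)) i j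
      map_add' := fun _ _ => rfl
      map_smul' := fun _ _ => rfl }
  have hT : ContDiff ℝ ∞ (fun Q : Cfg (Edge d L) N => fun (e : ↥Λ) (i j : Fin N) =>
      Q (torusEdge L (e : ZdEdge d)) i j) :=
    (LinearMap.toContinuousLinearMap Tl).contDiff
  refine ⟨hg.comp hT, ?_⟩
  intro e' a b hab
  set c : ℝ := ∑ e : ↥Λ,
    if torusEdge L (e : ZdEdge d) = e' then (1 : ℝ) else 0 with hc
  have hc0 : 0 ≤ c := Finset.sum_nonneg fun e _ => by split_ifs <;> norm_num
  have hdist : dist (fun (e : ↥Λ) (i j : Fin N) =>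
        emb a (torusEdge L (e : ZdEdge d)) i j)
      (fun (e : ↥Λ) (i j : Fin N) =>
        emb b (torusEdge L (e : ZdEdge d)) i j) ≤
      c * suFrobDist (a e') (b e') := by
    refine (dist_pi_le_iff (mul_nonneg hc0 (suFrobDist_nonneg _ _))).2 fun e => ?_
    by_cases he : torusEdge L (e : ZdEdge d) = e'
    · have h1 : (1 : ℝ) ≤ c := by
        rw [hc]
        refine Finset.single_le_sum (f := fun e : ↥Λ =>
          if torusEdge L (e : ZdEdge d) = e' then (1 : ℝ) else 0)
          (fun e _ => by split_ifs <;> norm_num) (Finset.mem_univ e) |>.trans' ?_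
        rw [if_pos he]
      have h2 : dist (fun i j : Fin N => emb a (torusEdge L (e : ZdEdge d)) i j)
          (fun i j : Fin N => emb b (torusEdge L (e : ZdEdge d)) i j) ≤
          suFrobDist (a e') (b e') := by
        rw [he]
        exact dist_suEntries_le_suFrobDist (a e') (b e')
      calc _ ≤ suFrobDist (a e') (b e') := h2
        _ = 1 * suFrobDist (a e') (b e') := (one_mul _).symm
        _ ≤ c * suFrobDist (a e') (b e') := mul_le_mul_of_nonneg_right h1 (suFrobDist_nonneg _ _)
    · have hsame : (fun i j : Fin N => emb a (torusEdge L (e : ZdEdge d)) i j) =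
          fun i j : Fin N => emb b (torusEdge L (e : ZdEdge d)) i j := by
        funext i j
        rw [emb_apply, emb_apply, hab _ he]
      rw [hsame, dist_self]
      exact mul_nonneg hc0 (suFrobDist_nonneg _ _)
  calc |g (fun (e : ↥Λ) (i j : Fin N) =>
          emb a (torusEdge L (e : ZdEdge d)) i j) -
        g (fun (e : ↥Λ) (i j : Fin N) =>
          emb b (torusEdge L (e : ZdEdge d)) i j)|
      ≤ K * dist (fun (e : ↥Λ) (i j : Fin N) =>
          emb a (torusEdge L (e : ZdEdge d)) i j)
        (fun (e : ↥Λ) (i j : Fin N) =>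
          emb b (torusEdge L (e : ZdEdge d)) i j) := by
        rw [← Real.dist_eq]; exact hgK.dist_le_mul _ _
    _ ≤ K * (c * suFrobDist (a e') (b e')) := mul_le_mul_of_nonneg_left hdist K.2
    _ = K * c * suFrobDist (a e') (b e') := by ring

/-- Total Lipschitz mass of the torus data: `Σ_{e'} K·#{e ∈ Λ : π_L e = e'} = K·|Λ|`. -/
theorem sum_torusData_eq {L : ℕ} [NeZero L] (Λ : Finset (ZdEdge d))
    (K : ℝ) :
    ∑ e' : Edge d L, K * ∑ e : ↥Λ,
        (if torusEdge L (e : ZdEdge d) = e' then (1 : ℝ) else 0) =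
      K * Λ.card := by
  classical
  rw [← Finset.mul_sum, Finset.sum_comm]
  congr 1
  have : ∀ e : ↥Λ, ∑ e' : Edge d L,
      (if torusEdge L (e : ZdEdge d) = e' then (1 : ℝ) else 0) = 1 :=
    fun e => by rw [Finset.sum_ite_eq]; simp
  simp_rw [this]
  simp

end Torus

end SharpClustering

end Summit.Ventures.YMGap
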